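import Literature.Geometry.Lorentzian.BondiMass
import HarnessLib

/-!
# The Komar integral of a vector field over a compact spacelike 2-surface

Topic `Literature/Geometry/Lorentzian` (definition request `defn-komarIntegral` of route
`FinalStateConjecture/NoParkingWithoutHorizon`; written, as asked, with `riemannianVolume (f^* g) 2`
of `Volume.lean` exactly as `LorentzianMetric.hawkingMass` is in `BondiMass.lean`).

Source: R. M. Wald, *General Relativity* (1984), §11.2, eq. (11.2.9): for a stationary,
asymptotically flat spacetime with timelike Killing field `ξ` which is vacuum near infinity,
`M = −(8π)⁻¹ ∫_S ε_{abcd} ∇^c ξ^d` over a 2-sphere `S` ("first given by Komar (1959)"; independent of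
`S` by Killing's equation; (11.2.10) is the Stokes/volume form
`M = 2∫_Σ (T_{ab} − ½ T g_{ab}) n^a ξ^b dV`). A. Komar, Phys. Rev. 113 (1959) 934;
R. Beig, Phys. Lett. A 69 (1978) 153 (Komar = ADM under stationary fall-off).

## Rendering

For a spacelike immersion `f : S → M` of a compact surface with null normal pair `P = (L, L̲)`,
`g(L, L̲) = −2` (`NullNormalPair`), the binormal of the normal bundle is `½ (L̲ ∧ L)`, and the
pullback to `S` of the 2-form `ε_{abcd} ∇^c T^d` is the density
`κ_T = ½ (g(∇_{L̲} T, L) − g(∇_L T, L̲))` times the area form. We therefore define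
`komarDensity g f P T y := ½ (g(∇_{L̲ y} T, L y) − g(∇_{L y} T, L̲ y))` at `f y` (Levi-Civita
covariant derivative `g.leviCivita`, Mathlib's argument order `cov T x v = ∇_v T`) and
`komarIntegral := (8π)⁻¹ ∫_S κ_T dA`, `dA = riemannianVolume (f^* g) 2`. ORIENTATION: with `L` the
OUTGOING normal the Schwarzschild sphere (`T = ∂_t`, `L, L̲ = F^{−1/2}∂_t ± F^{1/2}∂_r`, `F = 1 − 2M/r`)
has `κ_T = 2M/r²` and `komarIntegral = +M`, Wald's sign; swapping `L ↔ L̲` flips the sign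
(`komarIntegral_swap`). For a Killing field `T`, `κ_T = g(∇_{L̲} T, L) = −g(∇_L T, L̲)`
(`komarDensity_eq_of_isKillingField`). Not vendored: the route's divergence identity
`∇_b K^{ab} = 2R^a{}_b T^b − ∇_b π^{ab} + ∇^a tr π` (a statement about the route's slab data `π`, to
be filed as a route item) and Smarr's formula.

## References

* R. M. Wald, *General Relativity*, University of Chicago Press (1984), §11.2, eqs. (11.2.9),
  (11.2.10). [Wald1984GR]
* A. Komar, *Covariant conservation laws in general relativity*, Phys. Rev. 113 (1959) 934–936.
  [Komar1959]
* R. Beig, *Arnowitt–Deser–Misner energy and g₀₀*, Phys. Lett. A 69 (1978) 153–155. [Beig1978]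
-/

noncomputable section

open MeasureTheory Real
open scoped ContDiff Topology ENNReal Manifold

namespace Literature.Geometry.Lorentzian

namespace LorentzianMetric

variable {E : Type*} [NormedAddCommGroup E] [NormedSpace ℝ E] {H : Type*} [TopologicalSpace H]
  {I : ModelWithCorners ℝ E H} {M : Type*} [TopologicalSpace M] [ChartedSpace H M]
  {E'' : Type*} [NormedAddCommGroup E''] [NormedSpace ℝ E''] {H'' : Type*} [TopologicalSpace H'']
  {I'' : ModelWithCorners ℝ E'' H''} {S : Type*} [TopologicalSpace S] [ChartedSpace H'' S]
  [IsManifold I ∞ M] {n : ℕ∞ω}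
  [FiniteDimensional ℝ E] [CompleteSpace E] [Fact (1 ≤ n)] [FiniteDimensional ℝ E'']
  [IsManifold I'' ∞ S] [CompactSpace S] [T2Space S] [MeasurableSpace S] [BorelSpace S]
  (g : LorentzianMetric I n M) [g.HasLeviCivita] {τ : TimeOrientation g} (f : S → M)

/-- The **Komar density** of the vector field `T` on the spacelike surface `f : S → M` with null
normal pair `P = (L, L̲)`: `κ_T(y) = ½ (g(∇_{L̲ y} T, L y) − g(∇_{L y} T, L̲ y))` at the point `f y` —
the pullback of Wald's integrand `−ε_{abcd} ∇^c T^d` (11.2.9) written in the null frame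
(`g(L, L̲) = −2`); `∇ = g.leviCivita`. [cite: Wald1984GR, §11.2, eq. (11.2.9)] -/
def komarDensity (P : NullNormalPair I'' g τ f) (T : Π x : M, TangentSpace I x) (y : S) : ℝ :=
  (1 / 2) * (g.val (f y) (g.leviCivita T (f y) (P.Lbar y)) (P.L y) -
    g.val (f y) (g.leviCivita T (f y) (P.L y)) (P.Lbar y))

/-- The **Komar integral** `Komar(S; T) = (8π)⁻¹ ∮_S ∇^a T^b dS_{ab}` of the vector field `T` over
the compact spacelike immersed surface `f : S → M` with null normal pair `P` (Wald 1984, (11.2.9),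
`M = −(8π)⁻¹∫_S ε_{abcd}∇^cξ^d`, "first given by Komar (1959)"): `(8π)⁻¹ ∫_S κ_T dA` with
`dA = riemannianVolume (f^* g) 2` the area measure of the induced metric, exactly as in
`hawkingMass`. For the timelike Killing field of a stationary asymptotically flat spacetime, vacuum
near infinity, this is the Komar (= ADM, Beig 1978) mass; orientation: `+M` on Schwarzschild with `L`
outgoing. Junk value `0` for a non-integrable density (Bochner integral).
[cite: Wald1984GR, §11.2, eq. (11.2.9)] [cite: Komar1959, (definition of the conserved mass integral)] -/
def komarIntegral (hpb : PseudoRiemannianMetric.contMDiff_pullbackBilin I M I'' S n)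
    (hf : g.IsSpacelikeImmersion I'' f) (P : NullNormalPair I'' g τ f)
    (T : Π x : M, TangentSpace I x) : ℝ :=
  (8 * π)⁻¹ * ∫ y, g.komarDensity f P T y ∂(riemannianVolume (g.inducedRiemannianMetric f hpb hf) 2)

omit [FiniteDimensional ℝ E] [CompleteSpace E] [Fact (1 ≤ n)] [FiniteDimensional ℝ E'']
  [IsManifold I'' ∞ S] [CompactSpace S] [T2Space S] [MeasurableSpace S] [BorelSpace S] in
/-- Swapping the null normals changes the sign of the Komar density (the binormal `L̲ ∧ L` is
reversed). [folklore] -/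
theorem komarDensity_swap (P : NullNormalPair I'' g τ f) (T : Π x : M, TangentSpace I x) (y : S) :
    g.komarDensity f P.swap T y = -g.komarDensity f P T y := by
  simp only [komarDensity, NullNormalPair.swap]
  ring

omit [FiniteDimensional ℝ E] [CompleteSpace E] [Fact (1 ≤ n)] in
/-- … hence the Komar integral is odd under the swap `(L, L̲) ↦ (L̲, L)` (orientation reversal of the
normal bundle), in contrast with the Hawking mass (`hawkingMass_swap`). [folklore] -/
theorem komarIntegral_swap (hpb : PseudoRiemannianMetric.contMDiff_pullbackBilin I M I'' S n)
    (hf : g.IsSpacelikeImmersion I'' f) (P : NullNormalPair I'' g τ f)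
    (T : Π x : M, TangentSpace I x) :
    g.komarIntegral f hpb hf P.swap T = -g.komarIntegral f hpb hf P T := by
  simp only [komarIntegral, komarDensity_swap, integral_neg, mul_neg]

omit [FiniteDimensional ℝ E] [CompleteSpace E] [Fact (1 ≤ n)] [FiniteDimensional ℝ E'']
  [IsManifold I'' ∞ S] [CompactSpace S] [T2Space S] [MeasurableSpace S] [BorelSpace S] in
/-- **For a Killing field the two terms of the density agree**: Killing's equation
`g(∇_Y T, Z) + g(Y, ∇_Z T) = 0` (`PseudoRiemannianMetric.IsKillingField`) gives
`κ_T = g(∇_{L̲} T, L) = −g(∇_L T, L̲)` — the form in which (11.2.9) is usually evaluated (and the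
reason the Komar integral of a Killing field is independent of the surface, Wald p. 289).
[cite: Wald1984GR, §11.2, eq. (11.2.9) and the remark following it] -/
theorem komarDensity_eq_of_isKillingField (P : NullNormalPair I'' g τ f)
    {T : Π x : M, TangentSpace I x} (hT : g.IsKillingField T) (y : S) :
    g.komarDensity f P T y = g.val (f y) (g.leviCivita T (f y) (P.Lbar y)) (P.L y) := by
  have hK := hT.2 (f y) (P.Lbar y) (P.L y)
  have hs : g.val (f y) (P.Lbar y) (g.leviCivita T (f y) (P.L y)) =
      g.val (f y) (g.leviCivita T (f y) (P.L y)) (P.Lbar y) := g.symm _ _ _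
  simp only [komarDensity]
  linarith

end LorentzianMetric

end Literature.Geometry.Lorentzian

end
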